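import Summits.CriticalPhenomena.SAWScalingLimit.Theses.SAWRestrictionRigidity
import Summits.CriticalPhenomena.SAWScalingLimit.Theses.SAWGaussianRotation
import Summits.CriticalPhenomena.SAWScalingLimit.Theses.SAWInfinitesimalRigidity
import Summits.CriticalPhenomena.SAWScalingLimit.Theses.SAWPoissonBanks
import Summits.CriticalPhenomena.SAWScalingLimit.Theses.SAWRestrictionDescent
import Summits.CriticalPhenomena.SAWScalingLimit.Theses.SAWPtolemyBoundary
import Summits.CriticalPhenomena.SAWScalingLimit.Theorems.SAWConePseudogroupLatticeSimilarityOfLimit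
import Literature.Barriers.CriticalPhenomena.SupercriticalSAWSpaceFillingReversible
import Literature.Probability.RandomPlanarGeometry.SAWScalingLimitFamily
import Literature.Probability.RandomPlanarGeometry.ChordalReversibility
import Literature.Probability.RandomPlanarGeometry.LatticeSimilarityCovariance
import Literature.Probability.RandomPlanarGeometry.ChordalRestrictionMarkov
import Literature.Probability.LatticeModels.CellGridSaddleSymmetry
import HarnessLib

/-!
# `AxiomsOfLimit` (stmt-CriticalPhenomena-1370): the SOFT conjuncts of the crux, proved, and the glue

Supports item stmt-CriticalPhenomena-1370, the crux `AxiomsOfLimit` shared verbatim by the six SAW routes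
SAWRestrictionRigidity (primary decl), SAWGaussianRotation, SAWInfinitesimalRigidity, SAWPoissonBanks,
SAWRestrictionDescent, SAWPtolemyBoundary (line `split` of the crux, `Cruxes/AxiomsOfLimit/Lines/split.lean`,
whose sorry-free part this file lands under `Theorems/`).

`AxiomsOfLimit` says that every chordal family `P` which is the FULL scaling limit `(lim)` of the critical
`δℤ²` self-avoiding walk — for every Dobrushin domain and every endpoint approximation, i.e.
`SAW.IsScalingLimitFamily P` — satisfies six lattice-exact axioms:

  (i) restriction · (ii) a restriction-coupled domain-Markov kernel · (iii) reversibility ·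
  (iv) covariance under the lattice similarities `z ↦ r·iᵏ·z + w` · (v) covariance under `z ↦ z̄` ·
  (vi) a.s. simple curves meeting `∂D` only at the marked points.

Three of them — (iii), (iv), (v) — are EXACT symmetries of the `x_c`-weighted walk plus uniqueness of
weak limits along `δ → 0⁺`; no estimate is involved, and this file PROVES them for every scaling-limit
family:

* (iii) `isReversible_of_isScalingLimitFamily`. Walk reversal is a weight-preserving bijection
  `SAW(Ω_δ; a, b) ≃ SAW(Ω_δ; b, a)` whose polyline is the time-reversed polyline, so the critical law
  from `b_δ` to `a_δ` IS the reversed law from `a_δ` to `b_δ` at every mesh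
  (`SupercriticalSAW.tendstoLaw_reverse_of_tendstoLaw` at `x = x_c`, where `lawAt x_c = law` by `rfl`);
  `(b_δ, a_δ)` is an endpoint approximation of `(D; b, a)` (`isEndpointApprox_swap`); limits in law
  along `𝓝[>] 0` are unique (`TendstoLaw.map_eq`). Lawler–Schramm–Werner 2004 §3.1, §2.2.
* (iv) is the LANDED theorem of item stmt-CriticalPhenomena-7306
  (`LatticeSimilarityOfLimit.cov_similarity`, file `SAWConePseudogroupLatticeSimilarityOfLimit.lean`).
* (v) `conj_eq_of_isScalingLimitFamily`. Complex conjugation is the plane action of the cell symmetry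
  `CellSymmetry.reflect` of `ℤ²` (`(x₀, x₁) ↦ (x₀, −x₁)`), which transports the whole discretisation
  `Ω ↦ Ω_δ` (`CellSymmetry.discreteDomainGraph_adj_cell`); the transport lemma `map_curve_law_of_iso`
  gives the exact identity `conj_* P_{Ω,δ}(a,b) = P_{Ω̄,δ}(ā,b̄)` at every mesh (`map_curve_law_conj`),
  and the identification principle `LatticeSimilarityOfLimit.apply_eq_map_of_latticeIdentity` passes
  it to the limit. Beffara 2008, proof of Prop. 4.
* `isLatticeSimilarityCovariant_of_isScalingLimitFamily` bundles (iv) and (v).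

The three HARD conjuncts carry estimates and are NOT proved here: (vi) = the shared crux
stmt-CriticalPhenomena-0774 (`SimpleOfLimit`), (i) = the shared crux stmt-CriticalPhenomena-0773
(`RestrictionOfLimit`), and (ii) given (i) and (vi) (`MarkovOfLimit`, the restriction-coupled Markov
kernel of the limit; LSW04 §2.3: needs scaling limits of the SAW in SLIT domains, stable near the tip).
The GLUE `axiomsOfLimit_of_subs` (and its five siblings, one per route copy; the six copies of the crux
have syntactically identical bodies) derives the crux decl BY NAME from these three statements, stated in
the tree's bundled vocabulary (`SAW.IsScalingLimitFamily`, `ChordalFamily.IsRestriction`,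
`ChordalFamily.IsRestrictionMarkov`; the verbatim item texts are these up to `Iff.rfl`:
`SAW.isScalingLimitFamily_iff`, `ChordalFamily.isRestriction_iff`, `ChordalFamily.isRestrictionMarkov_iff`).
It is a CONDITIONAL result (hypotheses = open cruxes) recorded as the kernel-checked reduction of the
crux to its hard core; it closes nothing by itself.

References: G. F. Lawler, O. Schramm, W. Werner, *On the scaling limit of planar self-avoiding walk*
(2004), arXiv:math/0204277, §2.2, §2.3, §3.1, §3.4.5; V. Beffara, *Is critical 2D percolation
universal?* (2008), arXiv:0708.3908, §2.1 Prop. 4; P. Billingsley, *Convergence of probability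
measures*, 2nd ed. (1999), Thm 1.2. All [folklore] at the level of these statements.
-/

noncomputable section

open MeasureTheory Filter Topology Set
open scoped ComplexConjugate
open Literature.Probability.LatticeModels Literature.Probability.RandomPlanarGeometry
open Literature.Barriers.CriticalPhenomena (SupercriticalSAW.tendstoLaw_reverse_of_tendstoLaw)
open Summit.CriticalPhenomena.SAWScalingLimit.Cruxes.HexTransfer.PinTheShear (map_curve_law_of_iso)
open Summit.CriticalPhenomena.SAWScalingLimit.Theorems.LatticeSimilarityOfLimit
  (apply_eq_map_of_latticeIdentity cov_similarity)

namespace Summit.CriticalPhenomena.SAWScalingLimit.Theorems.AxiomsOfLimitSoft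

variable {P : ChordalFamily}

/-! ### (iii) Reversibility of the limit -/

/-- Swapping the two sequences of lattice endpoints of an endpoint approximation of `(D; a, b)` gives
an endpoint approximation of any Dobrushin structure `(D; b, a)` on the same carrier with the marked
points exchanged (reachability in `Ω_δ` is symmetric). [folklore] -/
theorem isEndpointApprox_swap {D D' : DobrushinDomain} {a b : ℝ → Site 2}
    (hab : SAW.IsEndpointApprox D a b) (hc : D'.carrier = D.carrier) (h0 : D'.pt 0 = D.pt 1)
    (h1 : D'.pt 1 = D.pt 0) : SAW.IsEndpointApprox D' b a := by
  refine ⟨?_, ?_, ?_⟩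
  · rw [hc]
    filter_upwards [hab.reachable] with δ hδ
    exact hδ.symm
  · rw [h0]
    exact hab.tendsto_snd
  · rw [h1]
    exact hab.tendsto_fst

/-- **Reversibility passes to the full scaling limit.** Every scaling-limit family of the critical
`δℤ²` SAW is reversible: `P (D; b, a) = reverse_* P (D; a, b)`. The law of the walk from `b_δ` to
`a_δ`, pushed to curves, is EXACTLY the time reversal of the law from `a_δ` to `b_δ` (the weight
`x_c^{|γ|}` depends on the length alone), time reversal is continuous on curve space, `(b_δ, a_δ)` is an
endpoint approximation of `(D; b, a)`, and limits in law along `δ → 0⁺` are unique.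
[cite: LawlerSchrammWerner2004SAW, §3.1 and §2.2] -/
theorem isReversible_of_isScalingLimitFamily (hP : SAW.IsScalingLimitFamily P) : P.IsReversible := by
  intro D D' hc h0 h1
  obtain ⟨a, b, hab⟩ := SAW.exists_isEndpointApprox D
  haveI := hP.isProbabilityMeasure D
  haveI := hP.isProbabilityMeasure D'
  -- the limit at `(D; b, a)` through the swapped approximation …
  have h₁ := hP.tendstoLaw (isEndpointApprox_swap hab hc h0 h1)
  rw [hc] at h₁
  -- … and the reversed limit at `(D; a, b)`: the same lattice laws (`lawAt x_c = law` is `rfl`)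
  have h₂ :
      TendstoLaw (fun δ (γ : SAW.DomainSAW D.carrier δ (b δ) (a δ)) => γ.curve)
        (fun δ => SAW.law D.carrier δ (b δ) (a δ)) (fun γ => (id γ).reverse) (P D) :=
    SupercriticalSAW.tendstoLaw_reverse_of_tendstoLaw (x := SAW.criticalFugacity) (hP.tendstoLaw hab)
  have key := TendstoLaw.map_eq h₁ h₂ aemeasurable_id
    (CurveClass.measurable_reverse.comp measurable_id).aemeasurable
  rwa [Measure.map_id] at key

/-! ### (v) Conjugation covariance: exact at every mesh, hence of the limit -/

-- Complex conjugation as a plane homeomorphism `z ↦ z̄` is Mathlib's `Complex.conjLIE.toHomeomorph`,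
-- written out in full below (no local abbreviation, so that this file declares no definition).

/-- `z ↦ z̄` has the same images as the plane action of the cell symmetry `CellSymmetry.reflect`.
[folklore] -/
theorem image_conjH (Ω : Set ℂ) : (Complex.conjLIE.toHomeomorph : ℂ ≃ₜ ℂ) '' Ω = CellSymmetry.reflect.plane '' Ω :=
  Set.image_congr fun z _ => by
    rw [conjLIE_toHomeomorph_apply, CellSymmetry.reflect_plane_apply]

/-- **Conjugation is an automorphism of the discretisation**: the axis reflection
`cellReflect = (x₀, x₁) ↦ (x₀, −x₁)` carries the graph `Ω_δ` onto `(Ω̄)_δ` (mesh vertices, the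
closed-segment edge rule and the union-of-largest-components convention are reflection-equivariant,
`CellSymmetry.discreteDomainGraph_adj_cell`). [folklore] -/
theorem discreteDomainGraph_adj_cellReflect {Ω : Set ℂ} {δ : ℝ} {x y : Site 2} :
    (discreteDomainGraph ((Complex.conjLIE.toHomeomorph : ℂ ≃ₜ ℂ) '' Ω) δ).Adj (cellReflect x) (cellReflect y) ↔
      (discreteDomainGraph Ω δ).Adj x y := by
  rw [image_conjH]
  exact CellSymmetry.reflect.discreteDomainGraph_adj_cell

/-- `z ↦ z̄` realises the reflection on mesh points: `conj (δ x) = δ (cellReflect x)`. [folklore] -/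
theorem conjH_meshPoint (δ : ℝ) (x : Site 2) :
    (Complex.conjLIE.toHomeomorph : ℂ ≃ₜ ℂ) (meshPoint δ x) = meshPoint δ (cellReflect x) := by
  rw [conjLIE_toHomeomorph_apply, show cellReflect = CellSymmetry.reflect.cell from rfl,
    CellSymmetry.reflect.meshPoint_cell, CellSymmetry.reflect_plane_apply]

/-- `z ↦ z̄` is affine on segments (it is `ℝ`-linear). [folklore] -/
theorem conjH_lineMap (x y : ℂ) (c : ℝ) :
    (Complex.conjLIE.toHomeomorph : ℂ ≃ₜ ℂ) (AffineMap.lineMap x y c) =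
      AffineMap.lineMap ((Complex.conjLIE.toHomeomorph : ℂ ≃ₜ ℂ) x) ((Complex.conjLIE.toHomeomorph : ℂ ≃ₜ ℂ) y) c := by
  simp only [conjLIE_toHomeomorph_apply, AffineMap.lineMap_apply_module, map_add,
    Complex.real_smul, map_mul, Complex.conj_ofReal]

/-- **Exact conjugation covariance of the critical `δℤ²` SAW law, at every mesh**: the critical SAW law
in `Ω` from `a` to `b`, pushed to curves and conjugated, IS the critical SAW law in `Ω̄` from the
reflected sites `(x₀, x₁) ↦ (x₀, −x₁)` pushed to curves (transport along the graph isomorphism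
`cellReflect : Ω_δ ≃g (Ω̄)_δ`, `map_curve_law_of_iso`). [cite: Beffara2008Universal, §2.1 (proof of Prop. 4)] -/
theorem map_curve_law_conj (Ω : Set ℂ) (δ : ℝ) (a b : Site 2) :
    ((SAW.law Ω δ a b).map (fun γ => γ.curve)).map
        (CurveClass.map ((Complex.conjLIE.toHomeomorph : ℂ ≃ₜ ℂ) : C(ℂ, ℂ))) =
      (SAW.law ((Complex.conjLIE.toHomeomorph : ℂ ≃ₜ ℂ) '' Ω) δ (cellReflect a) (cellReflect b)).map (fun γ => γ.curve) :=
  map_curve_law_of_iso ⟨cellReflect, discreteDomainGraph_adj_cellReflect⟩ _ measurable_curveClassMap_conj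
    conjH_lineMap (conjH_meshPoint δ) rfl rfl

/-- An endpoint approximation of `D` reflects to one of the conjugated domain `D̄ = D.map conj`
(reachability along the isomorphism; continuity of `z ↦ z̄`). [folklore] -/
theorem isEndpointApprox_conj {D : DobrushinDomain} {a b : ℝ → Site 2} (h : SAW.IsEndpointApprox D a b) :
    SAW.IsEndpointApprox (D.map Complex.conjLIE.toHomeomorph) (fun δ => cellReflect (a δ)) (fun δ => cellReflect (b δ)) := by
  refine ⟨?_, ?_, ?_⟩
  · filter_upwards [h.reachable] with δ hδ
    exact hδ.map ⟨cellReflect, discreteDomainGraph_adj_cellReflect.2⟩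
  · have key : (fun δ : ℝ => meshPoint δ (cellReflect (a δ))) =
        (Complex.conjLIE.toHomeomorph : ℂ ≃ₜ ℂ) ∘ fun δ => meshPoint δ (a δ) := by
      funext δ
      exact (conjH_meshPoint δ (a δ)).symm
    rw [key, MarkedDomain.pt_map]
    exact ((Complex.conjLIE.toHomeomorph : ℂ ≃ₜ ℂ).continuous.tendsto _).comp h.tendsto_fst
  · have key : (fun δ : ℝ => meshPoint δ (cellReflect (b δ))) =
        (Complex.conjLIE.toHomeomorph : ℂ ≃ₜ ℂ) ∘ fun δ => meshPoint δ (b δ) := by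
      funext δ
      exact (conjH_meshPoint δ (b δ)).symm
    rw [key, MarkedDomain.pt_map]
    exact ((Complex.conjLIE.toHomeomorph : ℂ ≃ₜ ℂ).continuous.tendsto _).comp h.tendsto_snd

/-- **Conjugation covariance passes to the full scaling limit**: `P (D̄) = conj_* (P D)` for every
scaling-limit family `P` of the critical `δℤ²` SAW (exact identity at every mesh `1/(n+1)` and the
identification principle: uniqueness of weak limits, Billingsley Thm 1.2).
[cite: Beffara2008Universal, §2.1 (proof of Prop. 4)] -/
theorem conj_eq_of_isScalingLimitFamily (hP : SAW.IsScalingLimitFamily P) (D : DobrushinDomain) :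
    P (D.map Complex.conjLIE.toHomeomorph) =
      (P D).map (CurveClass.map (Complex.conjLIE.toHomeomorph : C(ℂ, ℂ))) := by
  obtain ⟨a, b, hab⟩ := SAW.exists_isEndpointApprox D
  exact apply_eq_map_of_latticeIdentity hP _ hab (isEndpointApprox_conj hab)
    (fun _ => Nat.one_div_pos_of_nat) tendsto_one_div_add_atTop_nhds_zero_nat
    (fun _ => Nat.one_div_pos_of_nat) tendsto_one_div_add_atTop_nhds_zero_nat fun n =>
    map_curve_law_conj D.carrier _ (a _) (b _)

/-- **Lattice-similarity covariance of the limit, bundled** (clause (iv) = the landed item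
stmt-CriticalPhenomena-7306, `cov_similarity`; clause (v) = `conj_eq_of_isScalingLimitFamily`).
[folklore] -/
theorem isLatticeSimilarityCovariant_of_isScalingLimitFamily (hP : SAW.IsScalingLimitFamily P) :
    P.IsLatticeSimilarityCovariant :=
  ⟨fun D c hc w hcm => cov_similarity hP D c hc w hcm, conj_eq_of_isScalingLimitFamily hP⟩


/-! ### The registered stub `stub_latticeSymmetryPassage` of the line `split`, BY NAME

Conjuncts (iii), (iv), (v) of the crux for every scaling-limit family, in the tree's bundled vocabulary
(`ChordalFamily.IsReversible`, `ChordalFamily.IsLatticeSimilarityCovariant` — definitionally the three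
conjuncts of `AxiomsOfLimit`); this is stub S0 of the registered skeleton of stmt-CriticalPhenomena-1370
(and S1 of the earlier line `birth`). -/

/-- **Exact lattice symmetries pass to the full scaling limit** (registered stub
`stub_latticeSymmetryPassage` of crux stmt-CriticalPhenomena-1370, proved): every scaling-limit family of
the critical `δℤ²` SAW is reversible (`isReversible_of_isScalingLimitFamily`) and covariant under the
lattice similarities and under conjugation (`isLatticeSimilarityCovariant_of_isScalingLimitFamily`).
[folklore] -/
theorem stub_latticeSymmetryPassage :
    ∀ P : Literature.Probability.RandomPlanarGeometry.ChordalFamily, Literature.Probability.RandomPlanarGeometry.SAW.IsScalingLimitFamily P → P.IsReversible ∧ P.IsLatticeSimilarityCovariant :=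
  fun _ hP =>
    ⟨isReversible_of_isScalingLimitFamily hP, isLatticeSimilarityCovariant_of_isScalingLimitFamily hP⟩

/-! ### The glue: the three hard conjuncts imply the crux, BY NAME, at each of its six route copies

Hypotheses (tree vocabulary): `hS` = (vi) for every scaling-limit family (item stmt-0774 up to
`SAW.isScalingLimitFamily_iff`), `hR` = (i) (item stmt-0773), `hM` = (ii) given (i) and (vi). -/

section Glue

variable
  (hS : ∀ P : ChordalFamily, SAW.IsScalingLimitFamily P → ∀ D : DobrushinDomain,
    ∀ᵐ γ ∂(P D), γ ∈ CurveClass.simple ∧ γ.range ∩ frontier D.carrier ⊆ {D.pt 0, D.pt 1})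
  (hR : ∀ P : ChordalFamily, SAW.IsScalingLimitFamily P → P.IsRestriction)
  (hM : ∀ P : ChordalFamily, SAW.IsScalingLimitFamily P → P.IsRestriction →
    (∀ D : DobrushinDomain,
      ∀ᵐ γ ∂(P D), γ ∈ CurveClass.simple ∧ γ.range ∩ frontier D.carrier ⊆ {D.pt 0, D.pt 1}) →
    P.IsRestrictionMarkov)
include hS hR hM

/-- **Glue for `AxiomsOfLimit` (primary decl, route SAWRestrictionRigidity).** If every scaling-limit
family of the critical `δℤ²` SAW (vi) is carried by simple boundary-avoiding curves, (i) has the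
restriction property, and (ii) — given (i) and (vi) — has a restriction-coupled domain-Markov kernel,
then `AxiomsOfLimit` holds: (iii) reversibility, (iv) lattice-similarity covariance and (v) conjugation
covariance are the theorems of this file. Conditional on three open cruxes; closes nothing by itself.
[folklore] -/
theorem axiomsOfLimit_of_subs :
    Summit.CriticalPhenomena.SAWScalingLimit.Theses.SAWRestrictionRigidity.AxiomsOfLimit := by
  intro P hch hlim
  have hP : SAW.IsScalingLimitFamily P := ⟨hch, hlim⟩
  obtain ⟨Q, hQ, hK⟩ := hM P hP (hR P hP) (hS P hP)
  have hlat := isLatticeSimilarityCovariant_of_isScalingLimitFamily hP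
  exact ⟨hR P hP, ⟨Q, hQ, hK⟩, isReversible_of_isScalingLimitFamily hP, hlat.1, hlat.2, hS P hP⟩

/-- Glue for the copy of the crux at route SAWGaussianRotation (same term). [folklore] -/
theorem axiomsOfLimit_of_subs_gaussianRotation :
    Summit.CriticalPhenomena.SAWScalingLimit.Theses.SAWGaussianRotation.AxiomsOfLimit := by
  intro P hch hlim
  have hP : SAW.IsScalingLimitFamily P := ⟨hch, hlim⟩
  obtain ⟨Q, hQ, hK⟩ := hM P hP (hR P hP) (hS P hP)
  have hlat := isLatticeSimilarityCovariant_of_isScalingLimitFamily hP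
  exact ⟨hR P hP, ⟨Q, hQ, hK⟩, isReversible_of_isScalingLimitFamily hP, hlat.1, hlat.2, hS P hP⟩

/-- Glue for the copy of the crux at route SAWInfinitesimalRigidity (same term). [folklore] -/
theorem axiomsOfLimit_of_subs_infinitesimalRigidity :
    Summit.CriticalPhenomena.SAWScalingLimit.Theses.SAWInfinitesimalRigidity.AxiomsOfLimit := by
  intro P hch hlim
  have hP : SAW.IsScalingLimitFamily P := ⟨hch, hlim⟩
  obtain ⟨Q, hQ, hK⟩ := hM P hP (hR P hP) (hS P hP)
  have hlat := isLatticeSimilarityCovariant_of_isScalingLimitFamily hP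
  exact ⟨hR P hP, ⟨Q, hQ, hK⟩, isReversible_of_isScalingLimitFamily hP, hlat.1, hlat.2, hS P hP⟩

/-- Glue for the copy of the crux at route SAWPoissonBanks (same term). [folklore] -/
theorem axiomsOfLimit_of_subs_poissonBanks :
    Summit.CriticalPhenomena.SAWScalingLimit.Theses.SAWPoissonBanks.AxiomsOfLimit := by
  intro P hch hlim
  have hP : SAW.IsScalingLimitFamily P := ⟨hch, hlim⟩
  obtain ⟨Q, hQ, hK⟩ := hM P hP (hR P hP) (hS P hP)
  have hlat := isLatticeSimilarityCovariant_of_isScalingLimitFamily hP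
  exact ⟨hR P hP, ⟨Q, hQ, hK⟩, isReversible_of_isScalingLimitFamily hP, hlat.1, hlat.2, hS P hP⟩

/-- Glue for the copy of the crux at route SAWRestrictionDescent (same term). [folklore] -/
theorem axiomsOfLimit_of_subs_restrictionDescent :
    Summit.CriticalPhenomena.SAWScalingLimit.Theses.SAWRestrictionDescent.AxiomsOfLimit := by
  intro P hch hlim
  have hP : SAW.IsScalingLimitFamily P := ⟨hch, hlim⟩
  obtain ⟨Q, hQ, hK⟩ := hM P hP (hR P hP) (hS P hP)
  have hlat := isLatticeSimilarityCovariant_of_isScalingLimitFamily hP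
  exact ⟨hR P hP, ⟨Q, hQ, hK⟩, isReversible_of_isScalingLimitFamily hP, hlat.1, hlat.2, hS P hP⟩

/-- Glue for the copy of the crux at route SAWPtolemyBoundary (same term). [folklore] -/
theorem axiomsOfLimit_of_subs_ptolemyBoundary :
    Summit.CriticalPhenomena.SAWScalingLimit.Theses.SAWPtolemyBoundary.AxiomsOfLimit := by
  intro P hch hlim
  have hP : SAW.IsScalingLimitFamily P := ⟨hch, hlim⟩
  obtain ⟨Q, hQ, hK⟩ := hM P hP (hR P hP) (hS P hP)
  have hlat := isLatticeSimilarityCovariant_of_isScalingLimitFamily hP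
  exact ⟨hR P hP, ⟨Q, hQ, hK⟩, isReversible_of_isScalingLimitFamily hP, hlat.1, hlat.2, hS P hP⟩

end Glue

end Summit.CriticalPhenomena.SAWScalingLimit.Theorems.AxiomsOfLimitSoft

end
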